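import Summits.Ventures.HodgeRepro2.T5SU11SphericalDecayAsymptotic
import Summits.Ventures.HodgeRepro2.T5SU11SphericalUnique

/-!
# The boundary term at infinity for the decaying solution against a spherical function: `sinh 2R · (φ_{λ′} χ_λ′ − χ_λ φ_{λ′}′) → 0` for `1 < λ′ < λ`

The Green's bracket of the decaying solution `χ_λ` (row 448) against the spherical function `φ_{λ′}` is, by
`χ_λ′ = φ_λ′ T_λ − 1/(sinh 2t φ_λ)` (`sphDecay'_eq`, from the definitions of rows 443/447),

  `sinh 2R (φ_{λ′} χ_λ′ − χ_λ φ_{λ′}′) = T_λ(R) · (λ(λ−2) − λ′(λ′−2)) ∫_0^R sinh 2t φ_λ φ_{λ′} dt − φ_{λ′}(a_R)/φ_λ(a_R)`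

(row 338's Lagrange identity for the first term). For `1 < λ′ < λ` both terms tend to `0`: `φ_{λ′}/φ_λ ~ (c′/c) e^{(λ′−λ)R}`
(`tendsto_sph_hyp_div_atTop`), and `T_λ(R) ≤ 2K e^{−2(λ−1)R}` (row 450) against `∫_0^R ≤ C₀ + 2cc′ R e^{(λ+λ′−2)R}`
(the eventual bounds `φ_λ ≤ 2c e^{(λ−2)t}` from row 334's limits) gives `T_λ(R) ∫_0^R → 0` (`tendsto_tailIntegral_mul_integral`;
`R e^{(λ′−λ)R} → 0`). Hence **the boundary term at infinity vanishes** (`tendsto_green_bracket_decay`) — the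
second ingredient of the diagonalisation of the resolvent by the spherical transform. Nothing is claimed about (N).

Blind lane: Mathlib + the HodgeRepro2 prefix only; no sorry; axioms ⊆ {propext, Classical.choice,
Quot.sound}.
-/

namespace Summit.Ventures.HodgeRepro2.T5SU11ResolventBoundary

open Filter Topology MeasureTheory intervalIntegral
open Set (Ioi Icc)
open T5SU11Cartan T5SU11SphericalFunction T5SU11SphericalBounds T5SU11SphericalContinuous
  T5SU11SphericalAsymptotic T5SU11SphericalCfun T5SU11SphericalUnique T5SU11ReductionOfOrder
  T5SU11ReductionOfOrderInfinity T5SU11SphericalSolutionSpaceAll T5SU11SphericalDecay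
  T5SU11SphericalDecayAsymptotic

/-- `sinh x ≤ e^x/2`. -/
theorem sinh_le_exp_div_two (x : ℝ) : Real.sinh x ≤ Real.exp x / 2 := by
  rw [Real.sinh_eq]
  have := Real.exp_pos (-x)
  linarith

/-- `R e^{−aR} → 0` for `a > 0`. -/
theorem tendsto_mul_exp_neg_mul_atTop {a : ℝ} (ha : 0 < a) :
    Tendsto (fun R : ℝ => R * Real.exp (-a * R)) atTop (𝓝 0) := by
  have h := (Real.tendsto_pow_mul_exp_neg_atTop_nhds_zero 1).comp (tendsto_id.const_mul_atTop ha)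
  have h2 := h.div_const a
  rw [zero_div] at h2
  refine h2.congr' (Eventually.of_forall fun R => ?_)
  simp only [Function.comp_def, pow_one, id]
  field_simp

section measure

variable [MeasurableSpace Circle] [BorelSpace Circle]

/-! ### The ratio `φ_{λ′}/φ_λ → 0` -/

/-- **`φ_{λ′}(a_t)/φ_λ(a_t) → 0`** for `1 < λ′ < λ`. -/
theorem tendsto_sph_hyp_div_atTop {lam lam' : ℝ} (h1 : 1 < lam') (h2 : lam' < lam) :
    Tendsto (fun t => sph lam' (hyp t) / sph lam (hyp t)) atTop (𝓝 0) := by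
  have hc : 0 < cfun (2 - lam) := cfun_pos (by linarith)
  have hA := tendsto_exp_two_sub_mul_sph_hyp (lt_trans h1 h2)
  have hB := tendsto_exp_two_sub_mul_sph_hyp h1
  have hE : Tendsto (fun t => Real.exp ((lam' - lam) * t)) atTop (𝓝 0) := by
    have := Real.tendsto_exp_atBot.comp (tendsto_id.const_mul_atTop_of_neg (by linarith : lam' - lam < 0))
    simpa only [Function.comp_def, id] using this
  have h := (hB.div hA hc.ne').mul hE
  rw [mul_zero] at h
  refine h.congr' (Eventually.of_forall fun t => ?_)
  have hφ : sph lam (hyp t) ≠ 0 := (sph_hyp_pos lam t).ne'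
  have hE1 : Real.exp ((2 - lam) * t) ≠ 0 := (Real.exp_pos _).ne'
  have key : Real.exp ((2 - lam') * t) * Real.exp ((lam' - lam) * t) = Real.exp ((2 - lam) * t) := by
    rw [← Real.exp_add]
    congr 1
    ring
  show Real.exp ((2 - lam') * t) * sph lam' (hyp t) / (Real.exp ((2 - lam) * t) * sph lam (hyp t))
    * Real.exp ((lam' - lam) * t) = sph lam' (hyp t) / sph lam (hyp t)
  rw [← key]
  field_simp

/-! ### Eventual bounds -/

/-- Eventually `φ_λ(a_t) ≤ 2c(2 − λ) e^{(λ−2)t}` for `λ > 1`. -/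
theorem eventually_sph_hyp_le {lam : ℝ} (hlam : 1 < lam) :
    ∀ᶠ t in atTop, sph lam (hyp t) ≤ 2 * cfun (2 - lam) * Real.exp ((lam - 2) * t) := by
  have hc : 0 < cfun (2 - lam) := cfun_pos (by linarith)
  have h := (tendsto_exp_two_sub_mul_sph_hyp hlam).eventually (eventually_le_nhds (by linarith : cfun (2 - lam) < 2 * cfun (2 - lam)))
  filter_upwards [h] with t ht
  have hE : 0 < Real.exp ((lam - 2) * t) := Real.exp_pos _
  calc sph lam (hyp t) = Real.exp ((lam - 2) * t) * (Real.exp ((2 - lam) * t) * sph lam (hyp t)) := by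
        rw [← mul_assoc, ← Real.exp_add, show (lam - 2) * t + (2 - lam) * t = 0 by ring, Real.exp_zero, one_mul]
    _ ≤ Real.exp ((lam - 2) * t) * (2 * cfun (2 - lam)) := mul_le_mul_of_nonneg_left ht hE.le
    _ = 2 * cfun (2 - lam) * Real.exp ((lam - 2) * t) := by ring

/-- Eventually `T_λ(R) ≤ 2K e^{−2(λ−1)R}`, `K = 1/((λ − 1) c(2 − λ)²)`, for `λ > 1`. -/
theorem eventually_tailIntegral_le {lam : ℝ} (hlam : 1 < lam) :
    ∀ᶠ R in atTop, tailIntegral (fun t => sph lam (hyp t)) R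
      ≤ 2 * (1 / ((lam - 1) * cfun (2 - lam) ^ 2)) * Real.exp (-(2 * (lam - 1)) * R) := by
  have hc : 0 < cfun (2 - lam) := cfun_pos (by linarith)
  have hK : 0 < 1 / ((lam - 1) * cfun (2 - lam) ^ 2) := by
    have : 0 < lam - 1 := by linarith
    positivity
  have h := (tendsto_exp_mul_tailIntegral_sph hlam).eventually (eventually_le_nhds (by linarith : 1 / ((lam - 1) * cfun (2 - lam) ^ 2) < 2 * (1 / ((lam - 1) * cfun (2 - lam) ^ 2))))
  filter_upwards [h] with R hR
  have hE : 0 < Real.exp (-(2 * (lam - 1)) * R) := Real.exp_pos _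
  calc tailIntegral (fun t => sph lam (hyp t)) R
      = Real.exp (-(2 * (lam - 1)) * R) * (Real.exp (2 * (lam - 1) * R) * tailIntegral (fun t => sph lam (hyp t)) R) := by
        rw [← mul_assoc, ← Real.exp_add, show -(2 * (lam - 1)) * R + 2 * (lam - 1) * R = 0 by ring, Real.exp_zero,
          one_mul]
    _ ≤ Real.exp (-(2 * (lam - 1)) * R) * (2 * (1 / ((lam - 1) * cfun (2 - lam) ^ 2))) :=
        mul_le_mul_of_nonneg_left hR hE.le
    _ = 2 * (1 / ((lam - 1) * cfun (2 - lam) ^ 2)) * Real.exp (-(2 * (lam - 1)) * R) := by ring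

/-! ### `T_λ(R) ∫_0^R sinh 2t φ_λ φ_{λ′} → 0` -/

/-- The integrand `sinh 2t φ_λ φ_{λ′}` is continuous. -/
theorem continuous_integrand (lam lam' : ℝ) :
    Continuous fun t => Real.sinh (2 * t) * sph lam (hyp t) * sph lam' (hyp t) :=
  ((Real.continuous_sinh.comp (continuous_const.mul continuous_id)).mul (continuous_sph_hyp lam)).mul
    (continuous_sph_hyp lam')

/-- **`T_λ(R) · ∫_0^R sinh 2t φ_λ(a_t) φ_{λ′}(a_t) dt → 0`** for `1 < λ′ < λ`. -/
theorem tendsto_tailIntegral_mul_integral {lam lam' : ℝ} (h1 : 1 < lam') (h2 : lam' < lam) :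
    Tendsto (fun R => tailIntegral (fun t => sph lam (hyp t)) R
      * ∫ t in (0 : ℝ)..R, Real.sinh (2 * t) * sph lam (hyp t) * sph lam' (hyp t)) atTop (𝓝 0) := by
  have hlam : 1 < lam := lt_trans h1 h2
  have hc : 0 < cfun (2 - lam) := cfun_pos (by linarith)
  have hc' : 0 < cfun (2 - lam') := cfun_pos (by linarith)
  set K := 1 / ((lam - 1) * cfun (2 - lam) ^ 2) with hK
  have hKpos : 0 < K := by
    have : 0 < lam - 1 := by linarith
    positivity
  -- the threshold `T₀` beyond which both eventual bounds hold
  obtain ⟨T₀, hT₀⟩ := eventually_atTop.mp ((eventually_sph_hyp_le hlam).and (eventually_sph_hyp_le h1))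
  set M := max T₀ 0 with hM
  set C₀ := ∫ t in (0 : ℝ)..M, Real.sinh (2 * t) * sph lam (hyp t) * sph lam' (hyp t) with hC₀
  have hcont := continuous_integrand lam lam'
  have hnn : ∀ t, 0 ≤ t → 0 ≤ Real.sinh (2 * t) * sph lam (hyp t) * sph lam' (hyp t) := fun t ht =>
    mul_nonneg (mul_nonneg (Real.sinh_nonneg_iff.mpr (by linarith)) (sph_hyp_pos lam t).le) (sph_hyp_pos lam' t).le
  have hC₀nn : 0 ≤ C₀ := integral_nonneg (le_max_right _ _) (fun t ht => hnn t ht.1)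
  set cc := 2 * cfun (2 - lam) * cfun (2 - lam') with hcc
  -- the upper bound of the product for `R ≥ max T₀ 0`, `R > 0`
  have hbound : ∀ᶠ R in atTop, tailIntegral (fun t => sph lam (hyp t)) R
      * ∫ t in (0 : ℝ)..R, Real.sinh (2 * t) * sph lam (hyp t) * sph lam' (hyp t)
      ≤ 2 * K * C₀ * Real.exp (-(2 * (lam - 1)) * R) + 2 * K * cc * (R * Real.exp (-(lam - lam') * R)) := by
    filter_upwards [eventually_tailIntegral_le hlam, eventually_ge_atTop M, eventually_gt_atTop 0]
      with R hTR hR hR0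
    have hT0 : T₀ ≤ R := le_trans (le_max_left _ _) hR
    -- split the integral at `M`
    have hsplit : ∫ t in (0 : ℝ)..R, Real.sinh (2 * t) * sph lam (hyp t) * sph lam' (hyp t)
        = C₀ + ∫ t in M..R, Real.sinh (2 * t) * sph lam (hyp t) * sph lam' (hyp t) := by
      rw [hC₀, integral_add_adjacent_intervals (hcont.intervalIntegrable _ _) (hcont.intervalIntegrable _ _)]
    -- the tail piece: `0 ≤ … ≤ R · cc · e^{(λ+λ′−2)R}`
    have htail_nn : 0 ≤ ∫ t in M..R, Real.sinh (2 * t) * sph lam (hyp t) * sph lam' (hyp t) :=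
      integral_nonneg hR (fun t ht => hnn t (le_trans (le_max_right _ _) ht.1))
    have htail : ∫ t in M..R, Real.sinh (2 * t) * sph lam (hyp t) * sph lam' (hyp t)
        ≤ R * (cc * Real.exp ((lam + lam' - 2) * R)) := by
      have hM' : ∀ t ∈ Set.uIoc M R, ‖Real.sinh (2 * t) * sph lam (hyp t) * sph lam' (hyp t)‖
          ≤ cc * Real.exp ((lam + lam' - 2) * R) := by
        intro t ht
        rw [Set.uIoc_of_le hR] at ht
        have ht0 : 0 ≤ t := le_trans (le_max_right _ _) ht.1.le
        have htT : T₀ ≤ t := le_trans (le_max_left _ _) ht.1.le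
        have htR : t ≤ R := ht.2
        obtain ⟨hb1, hb2⟩ := hT₀ t htT
        have hs : Real.sinh (2 * t) ≤ Real.exp (2 * t) / 2 := sinh_le_exp_div_two _
        have hs0 : 0 ≤ Real.sinh (2 * t) := Real.sinh_nonneg_iff.mpr (by linarith)
        rw [Real.norm_eq_abs, abs_of_nonneg (hnn t ht0)]
        have hexp : Real.exp ((lam + lam' - 2) * t) ≤ Real.exp ((lam + lam' - 2) * R) :=
          Real.exp_le_exp.mpr (by nlinarith)
        calc Real.sinh (2 * t) * sph lam (hyp t) * sph lam' (hyp t)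
            ≤ (Real.exp (2 * t) / 2) * (2 * cfun (2 - lam) * Real.exp ((lam - 2) * t))
              * (2 * cfun (2 - lam') * Real.exp ((lam' - 2) * t)) :=
              mul_le_mul (mul_le_mul hs hb1 (sph_hyp_pos lam t).le (by positivity)) hb2
                (sph_hyp_pos lam' t).le (by positivity)
          _ = cc * Real.exp ((lam + lam' - 2) * t) := by
              rw [hcc, show Real.exp ((lam + lam' - 2) * t)
                  = Real.exp (2 * t) * Real.exp ((lam - 2) * t) * Real.exp ((lam' - 2) * t) by
                  rw [← Real.exp_add, ← Real.exp_add]; congr 1; ring]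
              ring
          _ ≤ cc * Real.exp ((lam + lam' - 2) * R) := by
              have : 0 ≤ cc := by rw [hcc]; positivity
              exact mul_le_mul_of_nonneg_left hexp this
      have hnorm := norm_integral_le_of_norm_le_const hM'
      rw [Real.norm_eq_abs, abs_of_nonneg htail_nn] at hnorm
      have habs : |R - M| ≤ R := by
        rw [abs_of_nonneg (by linarith)]
        linarith [le_max_right T₀ 0]
      have hcc0 : 0 ≤ cc * Real.exp ((lam + lam' - 2) * R) := by rw [hcc]; positivity
      calc ∫ t in M..R, Real.sinh (2 * t) * sph lam (hyp t) * sph lam' (hyp t)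
          ≤ cc * Real.exp ((lam + lam' - 2) * R) * |R - M| := hnorm
        _ ≤ cc * Real.exp ((lam + lam' - 2) * R) * R := mul_le_mul_of_nonneg_left habs hcc0
        _ = R * (cc * Real.exp ((lam + lam' - 2) * R)) := by ring
    have hTnn : 0 ≤ tailIntegral (fun t => sph lam (hyp t)) R :=
      (tailIntegral_pos (hφ_sph lam) (hpos_sph lam) (integrableOn_roIntegrand_sph hlam) hR0).le
    have hXnn : 0 ≤ C₀ + ∫ t in M..R, Real.sinh (2 * t) * sph lam (hyp t) * sph lam' (hyp t) := by linarith
    have hE : 0 ≤ 2 * K * Real.exp (-(2 * (lam - 1)) * R) := by positivity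
    rw [hsplit]
    calc tailIntegral (fun t => sph lam (hyp t)) R
          * (C₀ + ∫ t in M..R, Real.sinh (2 * t) * sph lam (hyp t) * sph lam' (hyp t))
        ≤ (2 * K * Real.exp (-(2 * (lam - 1)) * R)) * (C₀ + R * (cc * Real.exp ((lam + lam' - 2) * R))) :=
          mul_le_mul hTR (by linarith) hXnn hE
      _ = 2 * K * C₀ * Real.exp (-(2 * (lam - 1)) * R) + 2 * K * cc * (R * Real.exp (-(lam - lam') * R)) := by
          rw [show Real.exp (-(lam - lam') * R) = Real.exp (-(2 * (lam - 1)) * R) * Real.exp ((lam + lam' - 2) * R) by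
            rw [← Real.exp_add]; congr 1; ring]
          ring
  -- the lower bound `0`
  have hlower : ∀ᶠ R in atTop, 0 ≤ tailIntegral (fun t => sph lam (hyp t)) R
      * ∫ t in (0 : ℝ)..R, Real.sinh (2 * t) * sph lam (hyp t) * sph lam' (hyp t) := by
    filter_upwards [eventually_gt_atTop 0] with R hR0
    exact mul_nonneg (tailIntegral_pos (hφ_sph lam) (hpos_sph lam) (integrableOn_roIntegrand_sph hlam) hR0).le
      (integral_nonneg hR0.le (fun t ht => hnn t ht.1))
  -- the upper bound tends to `0`
  have hup : Tendsto (fun R => 2 * K * C₀ * Real.exp (-(2 * (lam - 1)) * R)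
      + 2 * K * cc * (R * Real.exp (-(lam - lam') * R))) atTop (𝓝 0) := by
    have hA : Tendsto (fun R : ℝ => Real.exp (-(2 * (lam - 1)) * R)) atTop (𝓝 0) := by
      have := Real.tendsto_exp_atBot.comp (tendsto_id.const_mul_atTop_of_neg (by linarith : -(2 * (lam - 1)) < 0))
      simpa only [Function.comp_def, id] using this
    have hB := tendsto_mul_exp_neg_mul_atTop (by linarith : 0 < lam - lam')
    have := (hA.const_mul (2 * K * C₀)).add (hB.const_mul (2 * K * cc))
    simpa only [mul_zero, add_zero] using this
  exact tendsto_of_tendsto_of_tendsto_of_le_of_le' tendsto_const_nhds hup hlower hbound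

/-! ### The boundary term -/

/-- **`χ_λ′ = φ_λ′ T_λ − 1/(sinh 2t φ_λ)`** on `(0, ∞)`, `λ > 1`. -/
theorem sphDecay'_eq {lam : ℝ} (hlam : 1 < lam) {t : ℝ} (ht : 0 < t) :
    sphDecay' lam t = deriv (fun t => sph lam (hyp t)) t * tailIntegral (fun t => sph lam (hyp t)) t
      - (Real.sinh (2 * t) * sph lam (hyp t))⁻¹ := by
  unfold sphDecay' decaySolution' secondSolution'
  rw [tailIntegral_eq (hφ_sph lam) (hpos_sph lam) (integrableOn_roIntegrand_sph hlam) ht]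
  ring

/-- **THE BOUNDARY TERM AT INFINITY VANISHES**: `sinh 2R · (φ_{λ′} χ_λ′ − χ_λ φ_{λ′}′) → 0` for `1 < λ′ < λ`. -/
theorem tendsto_green_bracket_decay {lam lam' : ℝ} (h1 : 1 < lam') (h2 : lam' < lam) :
    Tendsto (fun R => Real.sinh (2 * R) * (sph lam' (hyp R) * sphDecay' lam R
      - sphDecay lam R * deriv (fun t => sph lam' (hyp t)) R)) atTop (𝓝 0) := by
  have hlam := lt_trans h1 h2
  have hA := (tendsto_tailIntegral_mul_integral h1 h2).const_mul (lam * (lam - 2) - lam' * (lam' - 2))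
  have hB := tendsto_sph_hyp_div_atTop h1 h2
  have h := hA.sub hB
  simp only [mul_zero, sub_zero] at h
  refine h.congr' ?_
  filter_upwards [eventually_gt_atTop 0] with R hR
  have hL := lagrange_identity lam lam' R
  have hφ : sph lam (hyp R) ≠ 0 := (sph_hyp_pos lam R).ne'
  have hS : Real.sinh (2 * R) ≠ 0 := (sinh_two_mul_pos hR).ne'
  rw [sphDecay'_eq hlam hR]
  unfold sphDecay decaySolution
  have e : (lam * (lam - 2) - lam' * (lam' - 2)) * (tailIntegral (fun t => sph lam (hyp t)) R
      * ∫ t in (0 : ℝ)..R, Real.sinh (2 * t) * sph lam (hyp t) * sph lam' (hyp t))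
      = tailIntegral (fun t => sph lam (hyp t)) R * ((lam * (lam - 2) - lam' * (lam' - 2))
        * ∫ t in (0 : ℝ)..R, Real.sinh (2 * t) * sph lam (hyp t) * sph lam' (hyp t)) := by ring
  rw [e, hL]
  field_simp
  ring

end measure

end Summit.Ventures.HodgeRepro2.T5SU11ResolventBoundary
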